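import Summits.MatrixMultiplication.MatrixMultiplication.Theses.LevelGradedCohnUmans

/-!
# `LevelTwoBeatsCubes` (crux stmt-MatrixMultiplication-7612, route LevelGradedCohnUmans):
# the graded Neumann packing count and the cubic volume budget

Negative-side support file of the crux disprover (cdisprove seat); everything `sorry`-free.
These are the two group-free ingredients of the refutation
`LevelGradedCohnUmansLevelTwoBeatsCubes_refuted`:

* `card_add_card_le_finrank` — block-triangular evaluation count: if `J ≤ ℂ^G` contains, for every
  `a₀`, a function which is `δ_{a₀}` on the points `tA a` and `0` on the points `tS s`, and for
  every `s₀` a function which is `δ_{s₀}` on the points `tS s`, then `|A| + |S| ≤ dim J`.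
* `packing_X`, `packing_Z` — GRADED NEUMANN COUNT (the `J`-graded form of Neumann's
  `|S|(|T|+|U|-1) ≤ |G|` for TPP triples): if `X, Y, Z ⊆ G` are separated by functions of a
  right- (resp. left-) translation-invariant subspace `J ≤ ℂ^G` — for every target `(x₀, z₀)` some
  `f ∈ J` has `f(x⁻¹ y y'⁻¹ z) = [x = x₀ ∧ y = y' ∧ z = z₀]` on `X × Y × Y × Z` — then
  `|X||Z| + |X|(|Y|-1) ≤ dim J` (targets `X⁻¹Z` plus ONE translated slab `X⁻¹(Y∖y₁)·y₁⁻¹z₁`),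
  resp. `|X||Z| + (|Y|-1)|Z| ≤ dim J`.  Valid in every group, for every such `J`
  (a graded packing bound: barrier-type knowledge for graded Cohn–Umans designs).
* `cubic_le_real`, `cubic_le_nat`, `cubic_le_small`, `vol_le` — the volume budget: from the two
  counts, `|X||Y||Z| ≤ pD + p² - p³` with `p = min(|X|,|Z|)`, and `pD + p² - p³ ≤ B` for all `p`
  as soon as `4D + 1 ≤ 8B` and `4(4D+1)³ ≤ 27(8B-4D-1)²` (AM–GM at the critical point).
-/

namespace Summit.MatrixMultiplication.MatrixMultiplication.Theorems.LevelTwoBeatsCubes.Negative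

open Module

/-! ## Block-triangular evaluation count -/

section LinearAlgebra

variable {G : Type*} {A S : Type*} [Fintype A] [Fintype S]

/-- **Block-triangular evaluation count.** If `J ≤ ℂ^G` contains, for each `a₀ : A`, a function
equal to `δ_{a₀}` on the points `tA a` and vanishing on the points `tS s`, and for each `s₀ : S` a
function equal to `δ_{s₀}` on the points `tS s`, then `|A| + |S| ≤ dim J` (the evaluation map
`J → ℂ^{A ⊕ S}` is onto). -/
theorem card_add_card_le_finrank [Fintype G] (J : Submodule ℂ (G → ℂ)) (tA : A → G) (tS : S → G)
    (hA : ∀ a₀ : A, ∃ f ∈ J, f (tA a₀) = 1 ∧ (∀ a, a ≠ a₀ → f (tA a) = 0) ∧ ∀ s, f (tS s) = 0)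
    (hS : ∀ s₀ : S, ∃ f ∈ J, f (tS s₀) = 1 ∧ ∀ s, s ≠ s₀ → f (tS s) = 0) :
    Fintype.card A + Fintype.card S ≤ finrank ℂ J := by
  classical
  let t : A ⊕ S → G := Sum.elim tA tS
  let ψ : J →ₗ[ℂ] (A ⊕ S → ℂ) :=
    { toFun := fun f i => (f : G → ℂ) (t i)
      map_add' := fun f g => by funext i; simp
      map_smul' := fun c f => by funext i; simp }
  have hψ : ∀ (f : J) (i : A ⊕ S), ψ f i = (f : G → ℂ) (t i) := fun f i => rfl
  let e : A ⊕ S → (A ⊕ S → ℂ) := fun i j => if i = j then 1 else 0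
  have he_inl : ∀ a₀ : A, e (Sum.inl a₀) ∈ LinearMap.range ψ := by
    intro a₀
    obtain ⟨f, hf, h1, h0, hs⟩ := hA a₀
    refine LinearMap.mem_range.2 ⟨⟨f, hf⟩, ?_⟩
    funext j
    rcases j with a | s
    · by_cases h : a = a₀
      · subst h
        simp [hψ, e, t, h1]
      · have hne : a₀ ≠ a := fun h' => h h'.symm
        simp [hψ, e, t, h0 a h, hne]
    · simp [hψ, e, t, hs]
  have he_inr : ∀ s₀ : S, e (Sum.inr s₀) ∈ LinearMap.range ψ := by
    intro s₀
    obtain ⟨f, hf, h1, h0⟩ := hS s₀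
    have hu : ψ ⟨f, hf⟩ ∈ LinearMap.range ψ := LinearMap.mem_range_self ψ _
    have key : e (Sum.inr s₀) =
        ψ ⟨f, hf⟩ - ∑ a : A, (ψ ⟨f, hf⟩ (Sum.inl a)) • e (Sum.inl a) := by
      funext j
      rcases j with a | s
      · simp [hψ, e, t, Finset.sum_apply]
      · by_cases h : s = s₀
        · subst h
          simp [hψ, e, t, h1, Finset.sum_apply]
        · have hne : s₀ ≠ s := fun h' => h h'.symm
          simp [hψ, e, t, h0 s h, hne, Finset.sum_apply]
    rw [key]
    exact Submodule.sub_mem _ hu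
      (Submodule.sum_mem _ fun a _ => Submodule.smul_mem _ _ (he_inl a))
  have htop : LinearMap.range ψ = ⊤ := by
    rw [eq_top_iff]
    rintro v -
    rw [pi_eq_sum_univ v]
    refine Submodule.sum_mem _ fun i _ => Submodule.smul_mem _ _ ?_
    rcases i with a | s
    · exact he_inl a
    · exact he_inr s
  have hsurj : Function.Surjective ψ := LinearMap.range_eq_top.1 htop
  calc Fintype.card A + Fintype.card S = Fintype.card (A ⊕ S) := Fintype.card_sum.symm
    _ = finrank ℂ (A ⊕ S → ℂ) := (Module.finrank_fintype_fun_eq_card ℂ).symm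
    _ ≤ finrank ℂ J := LinearMap.finrank_le_finrank_of_surjective hsurj

end LinearAlgebra

/-! ## The graded Neumann count -/

section Packing

variable {G : Type*} [Group G] [Fintype G]

/-- **Graded Neumann count, `X`-slab.** If `X, Y, Z ⊆ G` are separated by functions of a
right-translation-invariant subspace `J ≤ ℂ^G`, then `|X||Z| + |X|(|Y|-1) ≤ dim J`
(targets `x⁻¹z` and the translated slab `x⁻¹ y y₁⁻¹ z₁`, `y ≠ y₁`). -/
theorem packing_X (J : Submodule ℂ (G → ℂ)) (hr : ∀ f ∈ J, ∀ h : G, (fun g => f (g * h)) ∈ J)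
    (X Y Z : Finset G)
    (hsep : ∀ x₀ ∈ X, ∀ z₀ ∈ Z, ∃ f ∈ J, ∀ x ∈ X, ∀ y ∈ Y, ∀ y' ∈ Y, ∀ z ∈ Z,
      (x = x₀ ∧ y = y' ∧ z = z₀ → f (x⁻¹ * y * y'⁻¹ * z) = 1) ∧
      (¬ (x = x₀ ∧ y = y' ∧ z = z₀) → f (x⁻¹ * y * y'⁻¹ * z) = 0))
    {y₁ z₁ : G} (hy₁ : y₁ ∈ Y) (hz₁ : z₁ ∈ Z) :
    X.card * Z.card + X.card * (Y.card - 1) ≤ finrank ℂ J := by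
  classical
  have h := card_add_card_le_finrank (A := ↥(X ×ˢ Z)) (S := ↥(X ×ˢ Y.erase y₁)) J
    (fun a => a.1.1⁻¹ * y₁ * y₁⁻¹ * a.1.2) (fun s => s.1.1⁻¹ * s.1.2 * y₁⁻¹ * z₁) ?_ ?_
  · simp only [Fintype.card_coe] at h
    rw [Finset.card_product, Finset.card_product, Finset.card_erase_of_mem hy₁] at h
    exact h
  · rintro ⟨⟨x₀, z₀⟩, h₀⟩
    rw [Finset.mem_product] at h₀
    obtain ⟨f, hf, hspec⟩ := hsep x₀ h₀.1 z₀ h₀.2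
    refine ⟨f, hf, ?_, ?_, ?_⟩
    · exact (hspec x₀ h₀.1 y₁ hy₁ y₁ hy₁ z₀ h₀.2).1 ⟨rfl, rfl, rfl⟩
    · rintro ⟨⟨x, z⟩, hxz⟩ hne
      rw [Finset.mem_product] at hxz
      refine (hspec x hxz.1 y₁ hy₁ y₁ hy₁ z hxz.2).2 ?_
      rintro ⟨rfl, -, rfl⟩
      exact hne rfl
    · rintro ⟨⟨x, y⟩, hxy⟩
      rw [Finset.mem_product, Finset.mem_erase] at hxy
      refine (hspec x hxy.1 y hxy.2.2 y₁ hy₁ z₁ hz₁).2 ?_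
      rintro ⟨-, hyy, -⟩
      exact hxy.2.1 hyy
  · rintro ⟨⟨x₀, y₀⟩, h₀⟩
    rw [Finset.mem_product, Finset.mem_erase] at h₀
    obtain ⟨f, hf, hspec⟩ := hsep x₀ h₀.1 z₁ hz₁
    refine ⟨fun g => f (g * (z₁⁻¹ * y₁ * y₀⁻¹ * z₁)), hr f hf _, ?_, ?_⟩
    · have e : x₀⁻¹ * y₀ * y₁⁻¹ * z₁ * (z₁⁻¹ * y₁ * y₀⁻¹ * z₁) = x₀⁻¹ * y₀ * y₀⁻¹ * z₁ := by group
      show f (x₀⁻¹ * y₀ * y₁⁻¹ * z₁ * (z₁⁻¹ * y₁ * y₀⁻¹ * z₁)) = 1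
      rw [e]
      exact (hspec x₀ h₀.1 y₀ h₀.2.2 y₀ h₀.2.2 z₁ hz₁).1 ⟨rfl, rfl, rfl⟩
    · rintro ⟨⟨x, y⟩, hxy⟩ hne
      rw [Finset.mem_product, Finset.mem_erase] at hxy
      have e : x⁻¹ * y * y₁⁻¹ * z₁ * (z₁⁻¹ * y₁ * y₀⁻¹ * z₁) = x⁻¹ * y * y₀⁻¹ * z₁ := by group
      show f (x⁻¹ * y * y₁⁻¹ * z₁ * (z₁⁻¹ * y₁ * y₀⁻¹ * z₁)) = 0
      rw [e]
      refine (hspec x hxy.1 y hxy.2.2 y₀ h₀.2.2 z₁ hz₁).2 ?_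
      rintro ⟨rfl, rfl, -⟩
      exact hne rfl

/-- **Graded Neumann count, `Z`-slab.** If `X, Y, Z ⊆ G` are separated by functions of a
left-translation-invariant subspace `J ≤ ℂ^G`, then `|X||Z| + (|Y|-1)|Z| ≤ dim J`. -/
theorem packing_Z (J : Submodule ℂ (G → ℂ)) (hl : ∀ f ∈ J, ∀ h : G, (fun g => f (h * g)) ∈ J)
    (X Y Z : Finset G)
    (hsep : ∀ x₀ ∈ X, ∀ z₀ ∈ Z, ∃ f ∈ J, ∀ x ∈ X, ∀ y ∈ Y, ∀ y' ∈ Y, ∀ z ∈ Z,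
      (x = x₀ ∧ y = y' ∧ z = z₀ → f (x⁻¹ * y * y'⁻¹ * z) = 1) ∧
      (¬ (x = x₀ ∧ y = y' ∧ z = z₀) → f (x⁻¹ * y * y'⁻¹ * z) = 0))
    {x₁ y₁ : G} (hx₁ : x₁ ∈ X) (hy₁ : y₁ ∈ Y) :
    X.card * Z.card + (Y.card - 1) * Z.card ≤ finrank ℂ J := by
  classical
  have h := card_add_card_le_finrank (A := ↥(X ×ˢ Z)) (S := ↥(Y.erase y₁ ×ˢ Z)) J
    (fun a => a.1.1⁻¹ * y₁ * y₁⁻¹ * a.1.2) (fun s => x₁⁻¹ * y₁ * s.1.1⁻¹ * s.1.2) ?_ ?_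
  · simp only [Fintype.card_coe] at h
    rw [Finset.card_product, Finset.card_product, Finset.card_erase_of_mem hy₁] at h
    exact h
  · rintro ⟨⟨x₀, z₀⟩, h₀⟩
    rw [Finset.mem_product] at h₀
    obtain ⟨f, hf, hspec⟩ := hsep x₀ h₀.1 z₀ h₀.2
    refine ⟨f, hf, ?_, ?_, ?_⟩
    · exact (hspec x₀ h₀.1 y₁ hy₁ y₁ hy₁ z₀ h₀.2).1 ⟨rfl, rfl, rfl⟩
    · rintro ⟨⟨x, z⟩, hxz⟩ hne
      rw [Finset.mem_product] at hxz
      refine (hspec x hxz.1 y₁ hy₁ y₁ hy₁ z hxz.2).2 ?_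
      rintro ⟨rfl, -, rfl⟩
      exact hne rfl
    · rintro ⟨⟨y, z⟩, hyz⟩
      rw [Finset.mem_product, Finset.mem_erase] at hyz
      refine (hspec x₁ hx₁ y₁ hy₁ y hyz.1.2 z hyz.2).2 ?_
      rintro ⟨-, hyy, -⟩
      exact hyz.1.1 hyy.symm
  · rintro ⟨⟨y₀, z₀⟩, h₀⟩
    rw [Finset.mem_product, Finset.mem_erase] at h₀
    obtain ⟨f, hf, hspec⟩ := hsep x₁ hx₁ z₀ h₀.2
    refine ⟨fun g => f ((x₁⁻¹ * y₀ * y₁⁻¹ * x₁) * g), hl f hf _, ?_, ?_⟩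
    · have e : x₁⁻¹ * y₀ * y₁⁻¹ * x₁ * (x₁⁻¹ * y₁ * y₀⁻¹ * z₀) = x₁⁻¹ * y₀ * y₀⁻¹ * z₀ := by group
      show f (x₁⁻¹ * y₀ * y₁⁻¹ * x₁ * (x₁⁻¹ * y₁ * y₀⁻¹ * z₀)) = 1
      rw [e]
      exact (hspec x₁ hx₁ y₀ h₀.1.2 y₀ h₀.1.2 z₀ h₀.2).1 ⟨rfl, rfl, rfl⟩
    · rintro ⟨⟨y, z⟩, hyz⟩ hne
      rw [Finset.mem_product, Finset.mem_erase] at hyz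
      have e : x₁⁻¹ * y₀ * y₁⁻¹ * x₁ * (x₁⁻¹ * y₁ * y⁻¹ * z) = x₁⁻¹ * y₀ * y⁻¹ * z := by group
      show f (x₁⁻¹ * y₀ * y₁⁻¹ * x₁ * (x₁⁻¹ * y₁ * y⁻¹ * z)) = 0
      rw [e]
      refine (hspec x₁ hx₁ y₀ h₀.1.2 y hyz.1.2 z hyz.2).2 ?_
      rintro ⟨-, rfl, rfl⟩
      exact hne rfl

end Packing

/-! ## The cubic volume budget -/

section Arith

/-- The cubic budget: if `0 ≤ D`, `4D + 1 ≤ 8B` and `4(4D+1)³ ≤ 27(8B-4D-1)²` then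
`pD + p² - p³ ≤ B` for every real `p ≥ 0` (AM–GM at the critical point of the cubic). -/
theorem cubic_le_real (D B p : ℝ) (hD : 0 ≤ D) (hp : 0 ≤ p) (h1 : 4 * D + 1 ≤ 8 * B)
    (h2 : 4 * (4 * D + 1) ^ 3 ≤ 27 * (8 * B - 4 * D - 1) ^ 2) :
    p * D + p ^ 2 - p ^ 3 ≤ B := by
  have hval : p * D + p ^ 2 - p ^ 3 = p * (D + p - p ^ 2) := by ring
  rw [hval]
  by_cases hyneg : D + p - p ^ 2 < 0
  · have : p * (D + p - p ^ 2) ≤ 0 := mul_nonpos_of_nonneg_of_nonpos hp hyneg.le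
    linarith
  push Not at hyneg
  -- AM-GM: 27 · x · y · y ≤ (x + 2y)³ with x = 2 (p - 1/2)², y = D + p - p², x + 2y = 2D + 1/2
  have hamgm : 27 * (2 * (p - 1 / 2) ^ 2) * (D + p - p ^ 2) ^ 2 ≤ (2 * D + 1 / 2) ^ 3 := by
    have hsum : (2 * (p - 1 / 2) ^ 2) + 2 * (D + p - p ^ 2) = 2 * D + 1 / 2 := by ring
    have key : ((2 * (p - 1 / 2) ^ 2) + 2 * (D + p - p ^ 2)) ^ 3
        - 27 * (2 * (p - 1 / 2) ^ 2) * (D + p - p ^ 2) ^ 2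
        = ((2 * (p - 1 / 2) ^ 2) - (D + p - p ^ 2)) ^ 2
          * ((2 * (p - 1 / 2) ^ 2) + 8 * (D + p - p ^ 2)) := by ring
    have hnn : (0 : ℝ) ≤ ((2 * (p - 1 / 2) ^ 2) - (D + p - p ^ 2)) ^ 2
          * ((2 * (p - 1 / 2) ^ 2) + 8 * (D + p - p ^ 2)) := by positivity
    rw [← hsum]
    linarith
  have hyle : D + p - p ^ 2 ≤ D + 1 / 4 := by nlinarith [sq_nonneg (p - 1 / 2)]
  by_contra hcon
  push Not at hcon
  have ht : B - (D + 1 / 4) / 2 < (p - 1 / 2) * (D + p - p ^ 2) := by nlinarith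
  have hB0 : 0 ≤ B - (D + 1 / 4) / 2 := by linarith
  have hsq : (B - (D + 1 / 4) / 2) * (B - (D + 1 / 4) / 2)
      < ((p - 1 / 2) * (D + p - p ^ 2)) * ((p - 1 / 2) * (D + p - p ^ 2)) :=
    mul_self_lt_mul_self hB0 ht
  have h27 : 27 * (((p - 1 / 2) * (D + p - p ^ 2)) * ((p - 1 / 2) * (D + p - p ^ 2)))
      ≤ (2 * D + 1 / 2) ^ 3 / 2 := by
    have : ((p - 1 / 2) * (D + p - p ^ 2)) * ((p - 1 / 2) * (D + p - p ^ 2))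
        = (2 * (p - 1 / 2) ^ 2) * (D + p - p ^ 2) ^ 2 / 2 := by ring
    rw [this]
    linarith
  nlinarith

/-- Natural-number form of the cubic budget. -/
theorem cubic_le_nat (D B : ℕ) (h1 : (4 * D + 1 : ℝ) ≤ 8 * B)
    (h2 : 4 * (4 * (D : ℝ) + 1) ^ 3 ≤ 27 * (8 * (B : ℝ) - 4 * D - 1) ^ 2) (p : ℕ) :
    p * D + p ^ 2 ≤ p ^ 3 + B := by
  have h := cubic_le_real D B p (Nat.cast_nonneg D) (Nat.cast_nonneg p) h1 h2
  have : (p * D + p ^ 2 : ℝ) ≤ p ^ 3 + B := by linarith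
  exact_mod_cast this

/-- The tiny cases (`D ≤ 2`, `D ≤ B`) of the cubic budget. -/
theorem cubic_le_small (D B : ℕ) (hDB : D ≤ B) (hD : D ≤ 2) (p : ℕ) :
    p * D + p ^ 2 ≤ p ^ 3 + B := by
  rcases p with _ | _ | p
  · simp
  · nlinarith [hDB]
  · have : (p + 2) * D ≤ (p + 2) * 2 := Nat.mul_le_mul_left _ hD
    nlinarith [this, Nat.zero_le (p ^ 3), Nat.zero_le (p ^ 2), Nat.zero_le p]

/-- The core counting step: the two graded Neumann counts `ac + a(b-1) ≤ D`, `ac + (b-1)c ≤ D`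
and the cubic budget give `abc ≤ B` (via `abc ≤ pD + p² - p³`, `p = min(a,c)`). -/
theorem vol_le (a b c D B : ℕ) (hb : 1 ≤ b)
    (N1 : a * c + a * (b - 1) ≤ D) (N2 : a * c + (b - 1) * c ≤ D)
    (hh : ∀ p : ℕ, p * D + p ^ 2 ≤ p ^ 3 + B) : a * b * c ≤ B := by
  obtain ⟨b, rfl⟩ : ∃ b', b = b' + 1 := ⟨b - 1, by omega⟩
  simp only [Nat.add_sub_cancel] at N1 N2
  rcases Nat.eq_zero_or_pos a with rfl | ha0
  · simp
  rcases Nat.eq_zero_or_pos c with rfl | hc0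
  · simp
  rcases le_total c a with hca | hac
  · have hc := hh c
    have key : c * (a * c + a * b) ≤ c * D := Nat.mul_le_mul_left _ N1
    have key' : (c : ℤ) * (a * c + a * b) ≤ c * D := by exact_mod_cast key
    have hc' : (c : ℤ) * D + c ^ 2 ≤ c ^ 3 + B := by exact_mod_cast hc
    have hca' : (c : ℤ) ≤ a := by exact_mod_cast hca
    have hc1 : (1 : ℤ) ≤ c := by exact_mod_cast hc0
    have hint : (0 : ℤ) ≤ c * (a - c) * (c - 1) :=
      mul_nonneg (mul_nonneg (by linarith) (by linarith)) (by linarith)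
    have goalZ : (a : ℤ) * (b + 1) * c ≤ B := by nlinarith [key', hc', hint]
    exact_mod_cast goalZ
  · have ha := hh a
    have key : a * (a * c + b * c) ≤ a * D := Nat.mul_le_mul_left _ N2
    have key' : (a : ℤ) * (a * c + b * c) ≤ a * D := by exact_mod_cast key
    have ha' : (a : ℤ) * D + a ^ 2 ≤ a ^ 3 + B := by exact_mod_cast ha
    have hac' : (a : ℤ) ≤ c := by exact_mod_cast hac
    have ha1 : (1 : ℤ) ≤ a := by exact_mod_cast ha0
    have hint : (0 : ℤ) ≤ a * (c - a) * (a - 1) :=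
      mul_nonneg (mul_nonneg (by linarith) (by linarith)) (by linarith)
    have goalZ : (a : ℤ) * (b + 1) * c ≤ B := by nlinarith [key', ha', hint]
    exact_mod_cast goalZ

end Arith

end Summit.MatrixMultiplication.MatrixMultiplication.Theorems.LevelTwoBeatsCubes.Negative
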